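import Literature.Computability.AlgebraicComplexity.BorderRankMatMul323Cert
import HarnessLib

/-!
# The `⟨3,2,3⟩` border apolarity test, torus-fixed candidates (II): the Weyl-group orbit cover (kernel runs)

Topic `Literature/Computability/AlgebraicComplexity`.  Kernel runs of the coverage check of
`BorderRankMatMul323Cert.lean`: each of the `17 550 = C(27,4)` omitted `4`-sets of weight lines of
`M_⟨323⟩(C*)^⊥` is moved, by the tabulated group element `tab4 a b c d` (one of the `72` elements of
`S₃(U) × S₂(V) × S₃(W)`, `actNat`), inside one of the `322` entries of `omitsTable`; split by the
smallest omitted line for the elaboration budget.  Theorems only; `cover_spec` is the usable form.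

## References

* A. Conner, A. Harper, J. M. Landsberg, *New lower bounds for matrix multiplication and `det₃`*,
  Forum Math. Pi 11 (2023) e17 = arXiv:1911.07981, Thm. 1.4(1) (= Thm. 1.5(1) of the journal
  version), §2.3–§2.5, §3 (tests), §4 (`M(C*)^⊥ = U* ⊗ 𝔰𝔩(V) ⊗ W`), §7.3 ("nine `𝔹`-fixed
  four-dimensional subspaces"). [ConnerHarperLandsberg2023]
-/

namespace Literature.Computability.AlgebraicComplexity

namespace MatMul323

/-- **Kernel run**: every omitted `4`-set `{a,b,c,d}`, `0 ≤ a < 1`, is moved by its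
canonicalising group element inside one of the `322` tabulated orbit representatives.
[cite: ConnerHarperLandsberg2023, Thm. 1.4(1) and §7.3 (the (210)- and (120)-tests for M_⟨233⟩)] -/
theorem coverRange_0_1 : coverRange 0 1 = true := by
  decide +kernel

/-- **Kernel run**: every omitted `4`-set `{a,b,c,d}`, `1 ≤ a < 2`, is moved by its
canonicalising group element inside one of the `322` tabulated orbit representatives.
[cite: ConnerHarperLandsberg2023, Thm. 1.4(1) and §7.3 (the (210)- and (120)-tests for M_⟨233⟩)] -/
theorem coverRange_1_2 : coverRange 1 2 = true := by
  decide +kernel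

/-- **Kernel run**: every omitted `4`-set `{a,b,c,d}`, `2 ≤ a < 4`, is moved by its
canonicalising group element inside one of the `322` tabulated orbit representatives.
[cite: ConnerHarperLandsberg2023, Thm. 1.4(1) and §7.3 (the (210)- and (120)-tests for M_⟨233⟩)] -/
theorem coverRange_2_4 : coverRange 2 4 = true := by
  decide +kernel

/-- **Kernel run**: every omitted `4`-set `{a,b,c,d}`, `4 ≤ a < 7`, is moved by its
canonicalising group element inside one of the `322` tabulated orbit representatives.
[cite: ConnerHarperLandsberg2023, Thm. 1.4(1) and §7.3 (the (210)- and (120)-tests for M_⟨233⟩)] -/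
theorem coverRange_4_7 : coverRange 4 7 = true := by
  decide +kernel

/-- **Kernel run**: every omitted `4`-set `{a,b,c,d}`, `7 ≤ a < 11`, is moved by its
canonicalising group element inside one of the `322` tabulated orbit representatives.
[cite: ConnerHarperLandsberg2023, Thm. 1.4(1) and §7.3 (the (210)- and (120)-tests for M_⟨233⟩)] -/
theorem coverRange_7_11 : coverRange 7 11 = true := by
  decide +kernel

/-- **Kernel run**: every omitted `4`-set `{a,b,c,d}`, `11 ≤ a < 27`, is moved by its
canonicalising group element inside one of the `322` tabulated orbit representatives.
[cite: ConnerHarperLandsberg2023, Thm. 1.4(1) and §7.3 (the (210)- and (120)-tests for M_⟨233⟩)] -/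
theorem coverRange_11_27 : coverRange 11 27 = true := by
  decide +kernel

/-- **The whole cover**: every omitted `4`-set `a < b < c < d < 27` is moved by the tabulated group
element `tab4 a b c d < 72` inside a tabulated orbit representative. [cite: ConnerHarperLandsberg2023, Thm. 1.4(1) and §7.3 (the (210)- and (120)-tests for M_⟨233⟩)] -/
theorem cover_spec {a b c d : ℕ} (hab : a < b) (hbc : b < c) (hcd : c < d) (hd : d < 27) :
    tab4 a b c d < 72 ∧ ∃ T ∈ omitsTable, actNat (tab4 a b c d) a ∈ T ∧ actNat (tab4 a b c d) b ∈ T ∧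
      actNat (tab4 a b c d) c ∈ T ∧ actNat (tab4 a b c d) d ∈ T := by
  have key : ∀ lo hi, coverRange lo hi = true → lo ≤ a → a < hi →
      tab4 a b c d < 72 ∧ coverWith (tab4 a b c d) a b c d = true := by
    intro lo hi h hlo hhi
    unfold coverRange at h
    rw [List.all_eq_true] at h
    have h1 := h a (List.mem_range'_1.2 ⟨hlo, by omega⟩)
    rw [List.all_eq_true] at h1
    have h2 := h1 b (List.mem_range.2 (by omega))
    simp only [hab, decide_true, Bool.not_true, Bool.false_or, List.all_eq_true] at h2
    have h3 := h2 c (List.mem_range.2 (by omega))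
    simp only [hbc, decide_true, Bool.not_true, Bool.false_or, List.all_eq_true] at h3
    have h4 := h3 d (List.mem_range.2 hd)
    simpa [hcd] using h4
  have hk : tab4 a b c d < 72 ∧ coverWith (tab4 a b c d) a b c d = true := by
    by_cases g0 : a < 1
    · exact key 0 1 coverRange_0_1 (by omega) g0
    by_cases g1 : a < 2
    · exact key 1 2 coverRange_1_2 (by omega) g1
    by_cases g2 : a < 4
    · exact key 2 4 coverRange_2_4 (by omega) g2
    by_cases g3 : a < 7
    · exact key 4 7 coverRange_4_7 (by omega) g3
    by_cases g4 : a < 11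
    · exact key 7 11 coverRange_7_11 (by omega) g4
    · exact key 11 27 coverRange_11_27 (by omega) (by omega)
  refine ⟨hk.1, ?_⟩
  have hforce : ∀ (n : ℕ) (f : ℕ → Bool), forceNat n f = f n := fun n f => by cases n <;> rfl
  have h := hk.2
  simp only [coverWith, hforce, List.any_eq_true, Bool.and_eq_true, decide_eq_true_eq] at h
  obtain ⟨T, hT, ⟨⟨hw, hx⟩, hy⟩, hz⟩ := h
  exact ⟨T, hT, hw, hx, hy, hz⟩

end MatMul323

end Literature.Computability.AlgebraicComplexity
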